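import Summits.MatrixMultiplication.MatrixMultiplication.Theorems.EdgePencilTropicalPair
import HarnessLib

/-!
# The purchase of record at arbitrary levels is EQUIVALENT to tropical domination at one base:
# `(∃ δ ∈ (0,1], RUNG♭(δ, N) for infinitely many N) ⟺ (∃ n ≥ 2, TROP(n, 2))`

Support kernel for `stmt-MatrixMultiplication-26697` (`TetraExcessZero`, route `TetrahedronCarving`; cut of
record `closes (TetraExcessZero) (TetraPlusTwo) : ω = 2`, UNCHANGED; lineage `decomp-mm-lens-6`, generation 43).
No item is added or changed; no definition is introduced. Notation as in `EdgePencilTropicalPair`: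
`W_n^{(e)} = sixTetra F n e`, `D_n = W_n^{(1)}`, `X₄(F) = DTensorClass.asymptoticSpectrumDTensors F 2`,
`[t] = DTensorClass.mk t`, `≲ = AsympLe (· ≤ ·)`, `RUNG♭(δ, N) : [W_N^{(⌈N^δ⌉)}] ≲ [D_N] + N⁴`,
`TROP(n, e) : ∀ φ ∈ X₄(F), φ[W_n^{(e)}] ≤ max (φ[D_n], n⁴)` (both spelled out in every statement).

§16 FROM ARBITRARY LEVELS TO ONE BASE (`trop_two_of_flatPurchase`). If `RUNG♭(δ, N)` holds at infinitely
many levels `N` (not necessarily powers of one base) and `2 ≤ n^δ`, then `TROP(n, 2)`: sandwich each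
purchased level `n^{j+1} ≤ N < n^{j+2}` between powers of `n` using the CLASS monotonicities in the level
(`mk_sixTetra_mono_level`) and in the bond (`2^{j+1} ≤ ⌈(n^{j+1})^δ⌉ ≤ ⌈N^δ⌉`), read at a violating point
`φ` (`w = φ[W_n^{(2)}] = (1+η)·M`, `M = max (φ[D_n], n⁴)`, `η > 0`): `w^{j+1} ≤ 2·M^{j+2}`, i.e.
`(1+η)^{j+1} ≤ 2M` for unboundedly many `j` — impossible.

§17 THE EQUIVALENCE (`exists_flatPurchase_iff_exists_trop`):

  `(∃ δ, 0 < δ ≤ 1 ∧ ∀ N₀ ∃ N ≥ N₀, RUNG♭(δ, N))  ⟺  (∃ n ≥ 2, TROP(n, 2))`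

(`⟹`: take any base `n ≥ 2^{1/δ}`; `⟸`: `δ = log_n 2` and `EdgePencilTropicalPair.purchase_pow_of_trop`,
`rectDim_pow_logb`). Consequences: REGULARISATION (`flatPurchase_pow_of_flatPurchase`) — the purchase at
infinitely many arbitrary levels with exponent `δ` implies the purchase at EVERY power of EVERY base `n` with
`n^δ ≥ 2` (exponent `log_n 2 ≤ δ`); and the EXACT KILL TEST for the whole target family of record
(`not_exists_flatPurchase_iff`): «no `δ > 0` works» ⟺ «at EVERY base `n ≥ 2` some `φ_n ∈ X₄(F)` has
`max (φ_n[D_n], n⁴) < φ_n[W_n^{(2)}]`». Over `ℂ` the left side of §17 is the hypothesis of the landed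
`EdgePencilFlatSummandPrice.sixRungPos_of_flatPurchase` and the right side that of
`EdgePencilTropicalPair.sixRungPos_of_trop`; both conclude `stub_sixRungPos` by name.

References: Strassen 1988 (spectral characterisation of `≲`) [Strassen1988]; Zuiddam 2018, Thm. 2.12,
Cor. 2.13 [Zuiddam2018]; Christandl–Vrana–Zuiddam 2023, Thm. 1.1 [ChristandlVranaZuiddam2023];
Christandl–Vrana–Zuiddam, arXiv:1609.07476, §1.1 [ChristandlVranaZuiddam2016].
No `sorry`, no new axiom, no instance, no notation, no definition.
-/

noncomputable section

set_option linter.dupNamespace false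

open Finset Literature.Computability.AlgebraicComplexity
open Summit.MatrixMultiplication.MatrixMultiplication.Theorems.TetrahedronTensor
open Summit.MatrixMultiplication.MatrixMultiplication.Theorems.TetraDiagonal
open Summit.MatrixMultiplication.MatrixMultiplication.Theses.TetrahedronCarving

namespace Summit.MatrixMultiplication.MatrixMultiplication.Theorems.EdgePencil

/-! ## §16 From arbitrary levels to one base -/

section Levels

variable {F : Type*} [Field F]

/-- `2 ≤ n^δ` with `2 ≤ n` forces `0 ≤ δ`. [folklore] -/
theorem nonneg_of_two_le_rpow {n : ℕ} (hn : 2 ≤ n) {δ : ℝ} (h2 : (2 : ℝ) ≤ (n : ℝ) ^ δ) : 0 ≤ δ := by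
  by_contra hδ
  rw [not_le] at hδ
  have hn1 : (1 : ℝ) < n := by exact_mod_cast (show 1 < n by omega)
  have := Real.rpow_lt_one_of_one_lt_of_neg hn1 hδ
  linarith

/-- `⌈N'^δ⌉ ≤ ⌈N^δ⌉` for `N' ≤ N`, `0 ≤ δ`. [folklore] -/
theorem rectDim_mono_level {N' N : ℕ} (h : N' ≤ N) {δ : ℝ} (hδ : 0 ≤ δ) : rectDim N' δ ≤ rectDim N δ := by
  unfold rectDim
  exact Nat.ceil_mono (Real.rpow_le_rpow (Nat.cast_nonneg N') (by exact_mod_cast h) hδ)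

/-- **FROM ARBITRARY LEVELS TO ONE BASE.** `RUNG♭(δ, N)` at infinitely many levels `N` and `2 ≤ n^δ`
(`2 ≤ n`) give `TROP(n, 2)`: every `φ ∈ X₄(F)` values `W_n^{(2)}` at most `max (φ[D_n], n⁴)`.
[cite: Zuiddam2018, Thm. 2.12] -/
theorem trop_two_of_flatPurchase {δ : ℝ} {n : ℕ} (hn : 2 ≤ n) (h2 : (2 : ℝ) ≤ (n : ℝ) ^ δ)
    (h : ∀ N₀ : ℕ, ∃ N : ℕ, N₀ ≤ N ∧
      AsympLe (fun x y : DTensorClass F 4 => x ≤ y) (DTensorClass.mk (sixTetra F N (rectDim N δ)))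
        (DTensorClass.mk (sixTetra F N 1) + ((N ^ 4 : ℕ) : DTensorClass F 4))) :
    ∀ φ ∈ DTensorClass.asymptoticSpectrumDTensors F 2,
      φ (DTensorClass.mk (sixTetra F n 2)) ≤ max (φ (DTensorClass.mk (sixTetra F n 1))) ((n : ℝ) ^ 4) := by
  intro φ hφ
  have hn1 : 1 < n := by omega
  have hn1' : 1 ≤ n := by omega
  have hδ0 : 0 ≤ δ := nonneg_of_two_le_rpow hn h2
  have hSP : IsStrassenPreorder (fun x y : DTensorClass F 4 => x ≤ y) :=
    DTensorClass.isStrassenPreorder F 2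
  have hφ' := DTensorClass.mem_asymptoticSpectrumDTensors_iff.1 hφ
  set a := φ (DTensorClass.mk (sixTetra F n 1)) with ha
  set w := φ (DTensorClass.mk (sixTetra F n 2)) with hw
  set M := max a ((n : ℝ) ^ 4) with hM
  by_contra hlt
  rw [not_le] at hlt
  have ha1 : 1 ≤ a := one_le_spectrum_sixTetra (F := F) hn1' le_rfl hφ
  have hM1 : 1 ≤ M := ha1.trans (le_max_left _ _)
  have hM0 : 0 < M := by linarith
  set η : ℝ := w / M - 1 with hη
  have hη0 : 0 < η := by
    rw [hη, sub_pos, one_lt_div hM0]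
    exact hlt
  have hwr : w = (1 + η) * M := by
    rw [hη]
    field_simp
    ring
  -- a purchased level `N ≥ n^{J+2}` with `J η ≥ 2M`
  set J : ℕ := ⌈2 * M / η⌉₊ with hJ
  obtain ⟨N, hN, hP⟩ := h (n ^ (J + 2))
  have hnJ : n ≤ n ^ (J + 2) :=
    calc n = n ^ 1 := (pow_one n).symm
      _ ≤ n ^ (J + 2) := Nat.pow_le_pow_right hn1' (by omega)
  have hnN : n ≤ N := hnJ.trans hN
  have hN0 : N ≠ 0 := by omega
  -- `n^{j+1} ≤ N < n^{j+2}`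
  have hk0 : Nat.log n N ≠ 0 := Nat.pos_iff_ne_zero.mp (Nat.log_pos hn1 hnN)
  obtain ⟨j, hj⟩ := Nat.exists_eq_succ_of_ne_zero hk0
  have hlow : n ^ (j + 1) ≤ N := by
    have := Nat.pow_log_le_self n hN0
    rwa [hj] at this
  have hup : N < n ^ (j + 1 + 1) := by
    have := Nat.lt_pow_succ_log_self hn1 N
    rwa [hj] at this
  have hJj : J < j := by
    have : n ^ (J + 2) < n ^ (j + 1 + 1) := lt_of_le_of_lt hN hup
    have := (Nat.pow_lt_pow_iff_right hn1).1 this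
    omega
  -- the sandwich of classes around the purchased level
  have hbond : 2 ^ (j + 1) ≤ rectDim N δ :=
    (two_pow_le_rectDim_pow h2 j).trans (rectDim_mono_level hlow hδ0)
  have hL : DTensorClass.mk (sixTetra F (n ^ (j + 1)) (2 ^ (j + 1))) ≤
      DTensorClass.mk (sixTetra F N (rectDim N δ)) :=
    (mk_sixTetra_mono_level hlow _).trans (mk_sixTetra_mono hbond)
  have hR : DTensorClass.mk (sixTetra F N 1) + ((N ^ 4 : ℕ) : DTensorClass F 4) ≤
      DTensorClass.mk (sixTetra F (n ^ (j + 1 + 1)) 1) +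
        (((n ^ (j + 1 + 1)) ^ 4 : ℕ) : DTensorClass F 4) :=
    DTensorClass.add_le_add (mk_sixTetra_mono_level hup.le _)
      (DTensorClass.natCast_le_natCast_iff.2 (Nat.pow_le_pow_left hup.le 4))
  have hchain := hSP.asympLe_trans (hSP.asympLe_of_le hL) (hSP.asympLe_trans hP (hSP.asympLe_of_le hR))
  -- read at `φ`
  have key := (DTensorClass.asympLe_iff_forall_mem_spectrum.1 hchain) φ hφ
  rw [hφ'.map_add, hφ'.map_natCast, ← spectrum_sixTetra_pow (F := F) hn j hφ, ← hw] at key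
  have hDpow : φ (DTensorClass.mk (sixTetra F (n ^ (j + 1 + 1)) 1)) = a ^ (j + 1 + 1) := by
    have := spectrum_sixTetra_pow (F := F) hn1' (j + 1) hφ
    rw [one_pow] at this
    rw [← this]
  have hcast : (((n ^ (j + 1 + 1)) ^ 4 : ℕ) : ℝ) = ((n : ℝ) ^ 4) ^ (j + 1 + 1) := by push_cast; ring
  rw [hDpow, hcast] at key
  have ha0 : 0 ≤ a := by linarith
  have hb0 : (0 : ℝ) ≤ (n : ℝ) ^ 4 := by positivity
  have h1 : a ^ (j + 1 + 1) ≤ M ^ (j + 1 + 1) := pow_le_pow_left₀ ha0 (le_max_left _ _) _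
  have h2' : ((n : ℝ) ^ 4) ^ (j + 1 + 1) ≤ M ^ (j + 1 + 1) := pow_le_pow_left₀ hb0 (le_max_right _ _) _
  have hMpow : 0 < M ^ (j + 1) := pow_pos hM0 _
  -- `(1+η)^{j+1} ≤ 2M`
  have hsmall : (1 + η) ^ (j + 1) ≤ 2 * M := by
    rw [hwr, mul_pow] at key
    have : (1 + η) ^ (j + 1) * M ^ (j + 1) ≤ 2 * M * M ^ (j + 1) := by
      calc (1 + η) ^ (j + 1) * M ^ (j + 1) ≤ a ^ (j + 1 + 1) + ((n : ℝ) ^ 4) ^ (j + 1 + 1) := key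
        _ ≤ M ^ (j + 1 + 1) + M ^ (j + 1 + 1) := add_le_add h1 h2'
        _ = 2 * M * M ^ (j + 1) := by ring
    exact le_of_mul_le_mul_right this hMpow
  -- Bernoulli: `(1+η)^{j+1} ≥ 1 + (j+1)η > 2M`
  have hbig : 2 * M < (1 + η) ^ (j + 1) := by
    have hb := one_add_mul_le_pow (by linarith : (-2 : ℝ) ≤ η) (j + 1)
    push_cast at hb
    have hJη : 2 * M ≤ (J : ℝ) * η := by
      have h1 : 2 * M / η ≤ (J : ℝ) := Nat.le_ceil _
      have h3 : 2 * M / η * η = 2 * M := by field_simp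
      nlinarith
    have hjJ : (J : ℝ) + 1 ≤ (j : ℝ) + 1 := by
      have : (J : ℝ) ≤ j := by exact_mod_cast hJj.le
      linarith
    nlinarith
  linarith

/-- **REGULARISATION**: the purchase of record at infinitely many arbitrary levels (exponent `δ`) implies the
purchase at EVERY power of every base `n ≥ 2` with `2 ≤ n^δ` (thickness `2^{k+1}`, i.e. exponent `log_n 2`).
[cite: Zuiddam2018, Thm. 2.12] -/
theorem flatPurchase_pow_of_flatPurchase {δ : ℝ} {n : ℕ} (hn : 2 ≤ n) (h2 : (2 : ℝ) ≤ (n : ℝ) ^ δ)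
    (h : ∀ N₀ : ℕ, ∃ N : ℕ, N₀ ≤ N ∧
      AsympLe (fun x y : DTensorClass F 4 => x ≤ y) (DTensorClass.mk (sixTetra F N (rectDim N δ)))
        (DTensorClass.mk (sixTetra F N 1) + ((N ^ 4 : ℕ) : DTensorClass F 4)))
    (k : ℕ) :
    AsympLe (fun x y : DTensorClass F 4 => x ≤ y)
      (DTensorClass.mk (sixTetra F (n ^ (k + 1)) (2 ^ (k + 1))))
      (DTensorClass.mk (sixTetra F (n ^ (k + 1)) 1) + (((n ^ (k + 1)) ^ 4 : ℕ) : DTensorClass F 4)) :=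
  purchase_pow_of_trop (by omega) hn (trop_two_of_flatPurchase hn h2 h) k

end Levels

/-! ## §17 The equivalence and the exact kill test for the target family -/

section Equivalence

variable (F : Type*) [Field F]

/-- **THE EQUIVALENCE.** The target family of record — `RUNG♭(δ, N)` at infinitely many levels for SOME
`δ ∈ (0, 1]` — holds iff at SOME base `n ≥ 2` every 4-party spectral point values the doubled-edge diamond
`W_n^{(2)}` at most `max (φ[D_n], n⁴)`. [cite: Strassen1988, Thm. (spectral characterisation)] -/
theorem exists_flatPurchase_iff_exists_trop :
    (∃ δ : ℝ, 0 < δ ∧ δ ≤ 1 ∧ ∀ N₀ : ℕ, ∃ N : ℕ, N₀ ≤ N ∧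
      AsympLe (fun x y : DTensorClass F 4 => x ≤ y) (DTensorClass.mk (sixTetra F N (rectDim N δ)))
        (DTensorClass.mk (sixTetra F N 1) + ((N ^ 4 : ℕ) : DTensorClass F 4))) ↔
    ∃ n : ℕ, 2 ≤ n ∧ ∀ φ ∈ DTensorClass.asymptoticSpectrumDTensors F 2,
      φ (DTensorClass.mk (sixTetra F n 2)) ≤ max (φ (DTensorClass.mk (sixTetra F n 1))) ((n : ℝ) ^ 4) := by
  constructor
  · rintro ⟨δ, hδ, -, h⟩
    -- a base with `n^δ ≥ 2`: any `n ≥ 2^{1/δ}`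
    set n : ℕ := max 2 ⌈(2 : ℝ) ^ (1 / δ)⌉₊ with hn
    have hn2 : 2 ≤ n := le_max_left _ _
    have h2 : (2 : ℝ) ≤ (n : ℝ) ^ δ := by
      have hle : (2 : ℝ) ^ (1 / δ) ≤ n := by
        have h1 : (2 : ℝ) ^ (1 / δ) ≤ (⌈(2 : ℝ) ^ (1 / δ)⌉₊ : ℝ) := Nat.le_ceil _
        have h2 : ((⌈(2 : ℝ) ^ (1 / δ)⌉₊ : ℕ) : ℝ) ≤ n := by exact_mod_cast le_max_right _ _
        exact h1.trans h2
      have := Real.rpow_le_rpow (by positivity) hle hδ.le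
      rwa [← Real.rpow_mul (by norm_num : (0 : ℝ) ≤ 2), one_div_mul_cancel hδ.ne', Real.rpow_one] at this
    exact ⟨n, hn2, trop_two_of_flatPurchase hn2 h2 h⟩
  · rintro ⟨n, hn, hT⟩
    have hn1' : (1 : ℝ) < n := by exact_mod_cast (show 1 < n by omega)
    refine ⟨Real.logb n 2, Real.logb_pos hn1' (by norm_num), ?_, fun N₀ => ⟨n ^ (N₀ + 1), ?_, ?_⟩⟩
    · rw [← Real.logb_self_eq_one hn1']
      exact Real.logb_le_logb_of_le hn1' (by norm_num) (by exact_mod_cast hn)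
    · have h1 : N₀ + 1 ≤ 2 ^ (N₀ + 1) := (Nat.lt_two_pow_self).le
      have h2 : 2 ^ (N₀ + 1) ≤ n ^ (N₀ + 1) := Nat.pow_le_pow_left hn _
      omega
    · have hr : rectDim (n ^ (N₀ + 1)) (Real.logb n 2) = 2 ^ (N₀ + 1) := by
        simpa using rectDim_pow_logb hn (show 1 ≤ 2 by norm_num) N₀
      rw [hr]
      exact purchase_pow_of_trop (by omega) hn hT N₀

/-- **THE EXACT KILL TEST for the target family of record**: no exponent `δ > 0` admits the purchase at
infinitely many levels iff at EVERY base `n ≥ 2` some spectral point separates `W_n^{(2)}` from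
`max (φ[D_n], n⁴)`. [cite: Strassen1988, Thm. (spectral characterisation)] -/
theorem not_exists_flatPurchase_iff :
    (¬ ∃ δ : ℝ, 0 < δ ∧ δ ≤ 1 ∧ ∀ N₀ : ℕ, ∃ N : ℕ, N₀ ≤ N ∧
      AsympLe (fun x y : DTensorClass F 4 => x ≤ y) (DTensorClass.mk (sixTetra F N (rectDim N δ)))
        (DTensorClass.mk (sixTetra F N 1) + ((N ^ 4 : ℕ) : DTensorClass F 4))) ↔
    ∀ n : ℕ, 2 ≤ n → ∃ φ ∈ DTensorClass.asymptoticSpectrumDTensors F 2,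
      max (φ (DTensorClass.mk (sixTetra F n 1))) ((n : ℝ) ^ 4) < φ (DTensorClass.mk (sixTetra F n 2)) := by
  rw [exists_flatPurchase_iff_exists_trop F]
  constructor
  · intro h n hn
    exact exists_separating_point_of_not_trop fun hT => h ⟨n, hn, hT⟩
  · rintro h ⟨n, hn, hT⟩
    obtain ⟨φ, hφ, hsep⟩ := h n hn
    exact absurd (hT φ hφ) (not_le.mpr hsep)

/-- **One separating point at one base kills a whole range of exponents**: `φ ∈ X₄(F)` with
`max (φ[D_n], n⁴) < φ[W_n^{(2)}]` refutes `RUNG♭(δ, ·)` at infinitely many levels for EVERY `δ` with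
`2 ≤ n^δ` (i.e. `δ ≥ log_n 2`). [cite: Zuiddam2018, Thm. 2.12] -/
theorem not_flatPurchase_of_separating_point {δ : ℝ} {n : ℕ} (hn : 2 ≤ n) (h2 : (2 : ℝ) ≤ (n : ℝ) ^ δ)
    {φ : DTensorClass F 4 → ℝ} (hφ : φ ∈ DTensorClass.asymptoticSpectrumDTensors F 2)
    (hsep : max (φ (DTensorClass.mk (sixTetra F n 1))) ((n : ℝ) ^ 4) < φ (DTensorClass.mk (sixTetra F n 2))) :
    ¬ ∀ N₀ : ℕ, ∃ N : ℕ, N₀ ≤ N ∧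
      AsympLe (fun x y : DTensorClass F 4 => x ≤ y) (DTensorClass.mk (sixTetra F N (rectDim N δ)))
        (DTensorClass.mk (sixTetra F N 1) + ((N ^ 4 : ℕ) : DTensorClass F 4)) :=
  fun h => absurd (trop_two_of_flatPurchase hn h2 h φ hφ) (not_le.mpr hsep)

end Equivalence

end Summit.MatrixMultiplication.MatrixMultiplication.Theorems.EdgePencil

end
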